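import Summits.FinalStateConjecture.FinalStateConjecture.Theorems.EIHFluxBalanceInertialRecessionStubHigherOrderApplyCB

/-!
# Route EIHFluxBalance — `InertialRecession` (E′), line `SketchCleanExcision`, skeleton r13,
# stub `stub_higherOrderSlaving` (EF): applying the coercivity statement to a re-centred field,
# order three

Helper file for the crux `stmt-FinalStateConjecture-17403`
(`Summit.FinalStateConjecture.FinalStateConjecture.Theses.EIHFluxBalance.InertialRecession`, E′),
registered stub `stub_higherOrderSlaving` (orders two and three of frozen-vacuum slaving).

The order-three companion of `…StubHigherOrderApplyCB.higherOrder_applyCB₂`: the coercivity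
clause is applied to `G`, `G' = G + ½(x⁰)² • W` as before (a SECOND-jet perturbation by the
variation form `W` of `(L, A, d)` — now `A = A″`, `d = d₃`), and compared with the THIRD-jet
perturbation `G₂ = G − ⅙(x⁰)³ • P` (`higherOrder_jets_smul_cube`) through the mixed symbol bound
`higherOrder_norm_ricAt_changes_add_le₃` at `v = e₀`:
`c · red(A, d) ≤ 4‖♯‖‖dx⁰‖² ‖W(x_y) − P(x_y)‖ + ‖D[Ric G₂](x_y) e₀‖ + ‖D[Ric G](x_y) e₀‖`
(`higherOrder_applyCB₃`).

No definitions, no named facts, no `sorry`.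
-/

set_option linter.dupNamespace false
set_option maxSynthPendingDepth 6
set_option synthInstance.maxHeartbeats 200000

noncomputable section

namespace Summit.FinalStateConjecture.FinalStateConjecture.Theorems.SublinearIsFree.Slaving

open scoped Topology ContDiff
open Filter Set Function Metric Literature.Geometry.Lorentzian
  Summit.FinalStateConjecture.FinalStateConjecture.Theorems
open MetricCoord

/-- `dx⁰(e₀) = 1`. [folklore] -/
theorem higherOrder_dx_zero_basisVector_zero : (E4.dx 0 : E4 →L[ℝ] ℝ) (E4.basisVector 0) = 1 := by
  show (E4.basisVector 0 : E4) 0 = 1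
  simp

set_option maxHeartbeats 3200000 in
/-- **Applying the coercivity clause, order three.** See the module docstring. [folklore] -/
theorem higherOrder_applyCB₃ {M a γ c ρin ρout η₀ : ℝ}
    (hcoer : ∀ (L : lorentzGroup) (A : E4 →L[ℝ] E4) (d : E4) (G G' : E4 → E4 →L[ℝ] E4 →L[ℝ] ℝ) (V : Set E4),
      |((L : E4 ≃L[ℝ] E4) (E4.basisVector 0)) 0| ≤ γ →
      (∀ u w : E4, Minkowski.bilin (A u) w + Minkowski.bilin u (A w) = 0) →
      MetricCoord.IsMetricOn G V → MetricCoord.IsMetricOn G' V →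
      (∀ y : E3, ρin ≤ ‖y‖ → ‖y‖ ≤ ρout → (E4.ofTimeSpace 0 y) ∈ V ∧
        ‖G (E4.ofTimeSpace 0 y) - boostedKerrBilin L 0 M a (E4.ofTimeSpace 0 y)‖ ≤ η₀ ∧
        G' (E4.ofTimeSpace 0 y) = G (E4.ofTimeSpace 0 y) ∧
        fderiv ℝ G' (E4.ofTimeSpace 0 y) = fderiv ℝ G (E4.ofTimeSpace 0 y) ∧
        ∀ v : E4, fderiv ℝ (fderiv ℝ G') (E4.ofTimeSpace 0 y) v =
          fderiv ℝ (fderiv ℝ G) (E4.ofTimeSpace 0 y) v + (v 0) • (E4.dx 0).smulRight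
            ((fderiv ℝ (Kerr.bilin M a) (poincareInv L 0 (E4.ofTimeSpace 0 y)) (A (poincareInv L 0 (E4.ofTimeSpace 0 y)) + d)).bilinearComp (((L : E4 ≃L[ℝ] E4).symm : E4 →L[ℝ] E4)) (((L : E4 ≃L[ℝ] E4).symm : E4 →L[ℝ] E4)) + (Kerr.bilin M a (poincareInv L 0 (E4.ofTimeSpace 0 y))).bilinearComp (A.comp (((L : E4 ≃L[ℝ] E4).symm : E4 →L[ℝ] E4))) (((L : E4 ≃L[ℝ] E4).symm : E4 →L[ℝ] E4)) + (Kerr.bilin M a (poincareInv L 0 (E4.ofTimeSpace 0 y))).bilinearComp (((L : E4 ≃L[ℝ] E4).symm : E4 →L[ℝ] E4)) (A.comp (((L : E4 ≃L[ℝ] E4).symm : E4 →L[ℝ] E4))))) →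
      ∃ y : E3, ρin ≤ ‖y‖ ∧ ‖y‖ ≤ ρout ∧
        c * (‖A (E4.basisVector 0)‖ + ‖E4.spatial d‖ + ‖a • A (E4.basisVector 3)‖) ≤
          ‖MetricCoord.ricAt G' (E4.ofTimeSpace 0 y) - MetricCoord.ricAt G (E4.ofTimeSpace 0 y)‖)
    (L : lorentzGroup) (hL : |((L : E4 ≃L[ℝ] E4) (E4.basisVector 0)) 0| ≤ γ) {A : E4 →L[ℝ] E4}
    (hA : ∀ u w : E4, Minkowski.bilin (A u) w + Minkowski.bilin u (A w) = 0) (d : E4)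
    {G : E4 → E4 →L[ℝ] E4 →L[ℝ] ℝ} {V : Set E4} (hG : IsMetricOn G V)
    (hVs : ∀ y : E3, ρin ≤ ‖y‖ → ‖y‖ ≤ ρout → E4.ofTimeSpace 0 y ∈ V ∧
      ‖G (E4.ofTimeSpace 0 y) - boostedKerrBilin L 0 M a (E4.ofTimeSpace 0 y)‖ ≤ η₀ ∧
      0 < Kerr.radius a (poincareInv L 0 (E4.ofTimeSpace 0 y)))
    {P : E4 → E4 →L[ℝ] E4 →L[ℝ] ℝ} (hP : ContDiffOn ℝ ∞ P V) (hPs : ∀ w ∈ V, ∀ u v, P w u v = P w v u) :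
    ∃ y : E3, ρin ≤ ‖y‖ ∧ ‖y‖ ≤ ρout ∧ ∃ V₁ : Set E4, E4.ofTimeSpace 0 y ∈ V₁ ∧ V₁ ⊆ V ∧
      IsMetricOn G V₁ ∧ IsMetricOn (fun w ↦ G w + ((E4.dx 0) w - 0) ^ 3 • ((-(6⁻¹ : ℝ)) • P w)) V₁ ∧
      (fun w ↦ G w + ((E4.dx 0) w - 0) ^ 3 • ((-(6⁻¹ : ℝ)) • P w)) (E4.ofTimeSpace 0 y) = G (E4.ofTimeSpace 0 y) ∧
      fderiv ℝ (fun w ↦ G w + ((E4.dx 0) w - 0) ^ 3 • ((-(6⁻¹ : ℝ)) • P w)) (E4.ofTimeSpace 0 y) = fderiv ℝ G (E4.ofTimeSpace 0 y) ∧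
      fderiv ℝ (fderiv ℝ (fun w ↦ G w + ((E4.dx 0) w - 0) ^ 3 • ((-(6⁻¹ : ℝ)) • P w))) (E4.ofTimeSpace 0 y) = fderiv ℝ (fderiv ℝ G) (E4.ofTimeSpace 0 y) ∧
      (∀ v, fderiv ℝ (fderiv ℝ (fderiv ℝ (fun w ↦ G w + ((E4.dx 0) w - 0) ^ 3 • ((-(6⁻¹ : ℝ)) • P w)))) (E4.ofTimeSpace 0 y) v =
        fderiv ℝ (fderiv ℝ (fderiv ℝ G)) (E4.ofTimeSpace 0 y) v +
          (E4.dx 0) v • (E4.dx 0).smulRight ((E4.dx 0).smulRight (-P (E4.ofTimeSpace 0 y)))) ∧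
      c * (‖A (E4.basisVector 0)‖ + ‖E4.spatial d‖ + ‖a • A (E4.basisVector 3)‖) ≤
        4 * ‖sharpAt G (E4.ofTimeSpace 0 y)‖ * ‖(E4.dx 0 : E4 →L[ℝ] ℝ)‖ ^ 2 *
          ‖((fderiv ℝ (Kerr.bilin M a) (poincareInv L 0 (E4.ofTimeSpace 0 y)) (A (poincareInv L 0 (E4.ofTimeSpace 0 y)) + d)).bilinearComp (((L : E4 ≃L[ℝ] E4).symm : E4 →L[ℝ] E4)) (((L : E4 ≃L[ℝ] E4).symm : E4 →L[ℝ] E4)) + (Kerr.bilin M a (poincareInv L 0 (E4.ofTimeSpace 0 y))).bilinearComp (A.comp (((L : E4 ≃L[ℝ] E4).symm : E4 →L[ℝ] E4))) (((L : E4 ≃L[ℝ] E4).symm : E4 →L[ℝ] E4)) + (Kerr.bilin M a (poincareInv L 0 (E4.ofTimeSpace 0 y))).bilinearComp (((L : E4 ≃L[ℝ] E4).symm : E4 →L[ℝ] E4)) (A.comp (((L : E4 ≃L[ℝ] E4).symm : E4 →L[ℝ] E4)))) - P (E4.ofTimeSpace 0 y)‖ +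
        ‖fderiv ℝ (ricAt (fun w ↦ G w + ((E4.dx 0) w - 0) ^ 3 • ((-(6⁻¹ : ℝ)) • P w))) (E4.ofTimeSpace 0 y) (E4.basisVector 0)‖ +
        ‖fderiv ℝ (ricAt G) (E4.ofTimeSpace 0 y) (E4.basisVector 0)‖ := by
  set ζ : E4 →L[ℝ] ℝ := E4.dx 0 with hζ
  have hζa : ∀ v : E4, ζ v = v 0 := fun v ↦ rfl
  set W : E4 → E4 →L[ℝ] E4 →L[ℝ] ℝ := fun w ↦ ((fderiv ℝ (Kerr.bilin M a) (poincareInv L 0 w) (A (poincareInv L 0 w) + d)).bilinearComp (((L : E4 ≃L[ℝ] E4).symm : E4 →L[ℝ] E4)) (((L : E4 ≃L[ℝ] E4).symm : E4 →L[ℝ] E4)) + (Kerr.bilin M a (poincareInv L 0 w)).bilinearComp (A.comp (((L : E4 ≃L[ℝ] E4).symm : E4 →L[ℝ] E4))) (((L : E4 ≃L[ℝ] E4).symm : E4 →L[ℝ] E4)) + (Kerr.bilin M a (poincareInv L 0 w)).bilinearComp (((L : E4 ≃L[ℝ] E4).symm : E4 →L[ℝ] E4)) (A.comp (((L : E4 ≃L[ℝ]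 E4).symm : E4 →L[ℝ] E4)))) with hWdef
  obtain ⟨hWc, hWs⟩ := higherOrder_varField L A d M a
  -- the working domain
  set V₀ : Set E4 := V ∩ {w : E4 | 0 < Kerr.radius a (poincareInv L 0 w)} with hV₀
  have hrad : IsOpen {w : E4 | 0 < Kerr.radius a (poincareInv L 0 w)} := by
    have hPf : (poincareInv L 0 : E4 → E4) = fun w ↦ ((L : E4 ≃L[ℝ] E4).symm : E4 →L[ℝ] E4) w :=
      funext fun w ↦ by simp [poincareInv]
    have hc : Continuous fun w : E4 ↦ Kerr.radius a (poincareInv L 0 w) := by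
      rw [hPf]; exact (Kerr.continuous_radius a).comp (ContinuousLinearMap.continuous _)
    exact isOpen_lt continuous_const hc
  have hV₀o : IsOpen V₀ := hG.isOpen.inter hrad
  have hG₀ : IsMetricOn G V₀ := KerrSchildChart.isMetricOn_mono hG hV₀o inter_subset_left
  have hW₀ : ContDiffOn ℝ ∞ W V₀ := hWc.mono inter_subset_right
  have hP₀ : ContDiffOn ℝ ∞ P V₀ := hP.mono inter_subset_left
  -- the two perturbations
  have hf : ContDiff ℝ ∞ (fun w : E4 ↦ (ζ w - 0) ^ 2) := (ζ.contDiff.sub contDiff_const).pow 2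
  have hg : ContDiff ℝ ∞ (fun w : E4 ↦ (ζ w - 0) ^ 3) := (ζ.contDiff.sub contDiff_const).pow 3
  have hH' : ContDiffOn ℝ ∞ (fun w ↦ (2⁻¹ : ℝ) • W w) V₀ := hW₀.const_smul _
  have hH₂ : ContDiffOn ℝ ∞ (fun w ↦ (-(6⁻¹ : ℝ)) • P w) V₀ := hP₀.const_smul _
  have hH's : ∀ w ∈ V₀, ∀ u v, ((2⁻¹ : ℝ) • W w) u v = ((2⁻¹ : ℝ) • W w) v u := fun w hw u v ↦ by
    simp only [_root_.smul_apply]; rw [hWs w hw.2 u v]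
  have hH₂s : ∀ w ∈ V₀, ∀ u v, ((-(6⁻¹ : ℝ)) • P w) u v = ((-(6⁻¹ : ℝ)) • P w) v u := fun w hw u v ↦ by
    simp only [_root_.smul_apply]; rw [hPs w hw.1 u v]
  obtain ⟨hG'm, hG'z⟩ := higherOrder_isMetricOn_add_smul hG₀ hf hH' hH's
  obtain ⟨hG₂m, hG₂z⟩ := higherOrder_isMetricOn_add_smul hG₀ hg hH₂ hH₂s
  set V₁' := {w | w ∈ V₀ ∧ ‖(ζ w - 0) ^ 2 • ((2⁻¹ : ℝ) • W w)‖ * ‖sharpAt G w‖ < 1} with hV₁'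
  set V₂' := {w | w ∈ V₀ ∧ ‖(ζ w - 0) ^ 3 • ((-(6⁻¹ : ℝ)) • P w)‖ * ‖sharpAt G w‖ < 1} with hV₂'
  set V₁ : Set E4 := V₁' ∩ V₂' with hV₁
  have hV₁o : IsOpen V₁ := hG'm.isOpen.inter hG₂m.isOpen
  have hV₁V₀ : V₁ ⊆ V₀ := fun w hw ↦ hw.1.1
  have hGV₁ : IsMetricOn G V₁ := KerrSchildChart.isMetricOn_mono hG₀ hV₁o hV₁V₀
  have hG'V₁ : IsMetricOn (fun w ↦ G w + (ζ w - 0) ^ 2 • ((2⁻¹ : ℝ) • W w)) V₁ :=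
    KerrSchildChart.isMetricOn_mono hG'm hV₁o inter_subset_left
  have hG₂V₁ : IsMetricOn (fun w ↦ G w + (ζ w - 0) ^ 3 • ((-(6⁻¹ : ℝ)) • P w)) V₁ :=
    KerrSchildChart.isMetricOn_mono hG₂m hV₁o inter_subset_right
  -- shell points
  have hx0 : ∀ y : E3, ζ (E4.ofTimeSpace 0 y) = 0 := fun y ↦ by rw [hζa]; exact E4.ofTimeSpace_apply_zero 0 y
  have hshell : ∀ y : E3, ρin ≤ ‖y‖ → ‖y‖ ≤ ρout → E4.ofTimeSpace 0 y ∈ V₀ ∧ E4.ofTimeSpace 0 y ∈ V₁ := by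
    intro y h1 h2
    obtain ⟨hV, -, hr⟩ := hVs y h1 h2
    have h0 : E4.ofTimeSpace 0 y ∈ V₀ := ⟨hV, hr⟩
    have hf0 : (ζ (E4.ofTimeSpace 0 y) - 0) ^ 2 = 0 := by rw [hx0]; norm_num
    have hg0 : (ζ (E4.ofTimeSpace 0 y) - 0) ^ 3 = 0 := by rw [hx0]; norm_num
    exact ⟨h0, hG'z _ h0 hf0, hG₂z _ h0 hg0⟩
  -- jets of the second-order perturbation at shell points
  have hjets : ∀ (H : E4 → E4 →L[ℝ] E4 →L[ℝ] ℝ), ContDiffOn ℝ ∞ H V₀ → ∀ x ∈ V₀, ζ x = 0 →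
      (fun w ↦ G w + (ζ w - 0) ^ 2 • H w) x = G x ∧
      fderiv ℝ (fun w ↦ G w + (ζ w - 0) ^ 2 • H w) x = fderiv ℝ G x ∧
      ∀ v, fderiv ℝ (fderiv ℝ (fun w ↦ G w + (ζ w - 0) ^ 2 • H w)) x v =
        fderiv ℝ (fderiv ℝ G) x v + ζ v • ζ.smulRight ((2 : ℝ) • H x) := by
    intro H hH x hx hζx
    obtain ⟨-, hp1, hp2, -⟩ := higherOrder_jets_smul_sq ζ 0 hV₀o hH hx hζx
    obtain ⟨ha1, ha2, -⟩ := fderiv_add_jets (H₂ := fun w ↦ (ζ w - 0) ^ 2 • H w) hG₀.contDiffOn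
      (hf.contDiffOn.smul hH) hV₀o hx
    refine ⟨?_, ?_, fun v ↦ ?_⟩
    · show G x + (ζ x - 0) ^ 2 • H x = G x
      rw [hζx]; simp
    · rw [ha1, hp1, add_zero]
    · rw [ha2, _root_.add_apply]
      congr 1
      ext w u
      rw [hp2 v w]
      simp only [_root_.smul_apply, ContinuousLinearMap.smulRight_apply, smul_eq_mul]
      ring
  -- jets of the third-order perturbation at shell points
  have hjets₃ : ∀ (H : E4 → E4 →L[ℝ] E4 →L[ℝ] ℝ), ContDiffOn ℝ ∞ H V₀ → ∀ x ∈ V₀, ζ x = 0 →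
      (fun w ↦ G w + (ζ w - 0) ^ 3 • H w) x = G x ∧
      fderiv ℝ (fun w ↦ G w + (ζ w - 0) ^ 3 • H w) x = fderiv ℝ G x ∧
      fderiv ℝ (fderiv ℝ (fun w ↦ G w + (ζ w - 0) ^ 3 • H w)) x = fderiv ℝ (fderiv ℝ G) x ∧
      ∀ v, fderiv ℝ (fderiv ℝ (fderiv ℝ (fun w ↦ G w + (ζ w - 0) ^ 3 • H w))) x v =
        fderiv ℝ (fderiv ℝ (fderiv ℝ G)) x v + ζ v • ζ.smulRight (ζ.smulRight ((6 : ℝ) • H x)) := by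
    intro H hH x hx hζx
    obtain ⟨-, hp1, hp2, hp3⟩ := higherOrder_jets_smul_cube ζ 0 hV₀o hH hx hζx
    obtain ⟨ha1, ha2, ha3⟩ := fderiv_add_jets (H₂ := fun w ↦ (ζ w - 0) ^ 3 • H w) hG₀.contDiffOn
      (hg.contDiffOn.smul hH) hV₀o hx
    refine ⟨?_, ?_, ?_, fun v ↦ ?_⟩
    · show G x + (ζ x - 0) ^ 3 • H x = G x
      rw [hζx]; simp
    · rw [ha1, hp1, add_zero]
    · rw [ha2, hp2, add_zero]
    · rw [ha3, _root_.add_apply]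
      congr 1
      ext w u r
      rw [hp3 v w u]
      simp only [_root_.smul_apply, ContinuousLinearMap.smulRight_apply, smul_eq_mul]
      ring
  -- apply the coercivity clause
  obtain ⟨y, hy1, hy2, hcb⟩ := hcoer L A d G (fun w ↦ G w + (ζ w - 0) ^ 2 • ((2⁻¹ : ℝ) • W w)) V₁
    hL hA hGV₁ hG'V₁ (fun y h1 h2 ↦ by
      obtain ⟨h0, h1'⟩ := hshell y h1 h2
      obtain ⟨-, hclose, -⟩ := hVs y h1 h2
      obtain ⟨j0, j1, j2⟩ := hjets _ hH' _ h0 (hx0 y)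
      refine ⟨h1', hclose, j0, j1, fun v ↦ ?_⟩
      rw [j2 v, smul_smul, mul_inv_cancel₀ (two_ne_zero (α := ℝ)), one_smul]
      rfl)
  obtain ⟨hy0, hyV₁⟩ := hshell y hy1 hy2
  set x : E4 := E4.ofTimeSpace 0 y with hx
  obtain ⟨j0, j1, j2, j3⟩ := hjets₃ _ hH₂ _ hy0 (hx0 y)
  have j3' : ∀ v, fderiv ℝ (fderiv ℝ (fderiv ℝ (fun w ↦ G w + (ζ w - 0) ^ 3 • ((-(6⁻¹ : ℝ)) • P w)))) x v =
      fderiv ℝ (fderiv ℝ (fderiv ℝ G)) x v + ζ v • ζ.smulRight (ζ.smulRight (-P x)) := fun v ↦ by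
    rw [j3 v, smul_smul, show (6 : ℝ) * -6⁻¹ = -1 by norm_num, neg_one_smul]
  obtain ⟨k0, k1, k2⟩ := hjets _ hH' _ hy0 (hx0 y)
  have k2' : ∀ v, fderiv ℝ (fderiv ℝ (fun w ↦ G w + (ζ w - 0) ^ 2 • ((2⁻¹ : ℝ) • W w))) x v =
      fderiv ℝ (fderiv ℝ G) x v + ζ v • ζ.smulRight (W x) := fun v ↦ by
    rw [k2 v, smul_smul, mul_inv_cancel₀ (two_ne_zero (α := ℝ)), one_smul]
  have hPx : ∀ u w, (-P x) u w = (-P x) w u := fun u w ↦ by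
    simp only [_root_.neg_apply, hPs x hy0.1 u w]
  have hsym := higherOrder_norm_ricAt_changes_add_le₃ hGV₁ hG₂V₁ hG'V₁ hyV₁ hPx j0 j1 j2 j3' k0 k1 k2'
    (E4.basisVector 0)
  have hζe : ζ (E4.basisVector 0) = 1 := higherOrder_dx_zero_basisVector_zero
  rw [hζe, one_smul, abs_one, mul_one] at hsym
  refine ⟨y, hy1, hy2, V₁, hyV₁, fun w hw ↦ (hV₁V₀ hw).1, hGV₁, hG₂V₁, j0, j1, j2, j3', ?_⟩
  have htri : ‖ricAt (fun w ↦ G w + (ζ w - 0) ^ 2 • ((2⁻¹ : ℝ) • W w)) x - ricAt G x‖ ≤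
      ‖(fderiv ℝ (ricAt (fun w ↦ G w + (ζ w - 0) ^ 3 • ((-(6⁻¹ : ℝ)) • P w))) x (E4.basisVector 0) -
          fderiv ℝ (ricAt G) x (E4.basisVector 0)) +
        (ricAt (fun w ↦ G w + (ζ w - 0) ^ 2 • ((2⁻¹ : ℝ) • W w)) x - ricAt G x)‖ +
      ‖fderiv ℝ (ricAt (fun w ↦ G w + (ζ w - 0) ^ 3 • ((-(6⁻¹ : ℝ)) • P w))) x (E4.basisVector 0) -
          fderiv ℝ (ricAt G) x (E4.basisVector 0)‖ := by
    have h := norm_sub_le ((fderiv ℝ (ricAt (fun w ↦ G w + (ζ w - 0) ^ 3 • ((-(6⁻¹ : ℝ)) • P w))) x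
        (E4.basisVector 0) - fderiv ℝ (ricAt G) x (E4.basisVector 0)) +
        (ricAt (fun w ↦ G w + (ζ w - 0) ^ 2 • ((2⁻¹ : ℝ) • W w)) x - ricAt G x))
      (fderiv ℝ (ricAt (fun w ↦ G w + (ζ w - 0) ^ 3 • ((-(6⁻¹ : ℝ)) • P w))) x (E4.basisVector 0) -
        fderiv ℝ (ricAt G) x (E4.basisVector 0))
    rwa [add_sub_cancel_left] at h
  have hlast : ‖fderiv ℝ (ricAt (fun w ↦ G w + (ζ w - 0) ^ 3 • ((-(6⁻¹ : ℝ)) • P w))) x (E4.basisVector 0) -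
      fderiv ℝ (ricAt G) x (E4.basisVector 0)‖ ≤
      ‖fderiv ℝ (ricAt (fun w ↦ G w + (ζ w - 0) ^ 3 • ((-(6⁻¹ : ℝ)) • P w))) x (E4.basisVector 0)‖ +
      ‖fderiv ℝ (ricAt G) x (E4.basisVector 0)‖ := norm_sub_le _ _
  have hWP : ‖-P x + W x‖ = ‖W x - P x‖ := by rw [neg_add_eq_sub]
  rw [hWP] at hsym
  linarith [hcb, htri, hlast, hsym]

/-- **Registered one-line carrier form** (`higherOrder_dxZeroE0_EF`) of
`higherOrder_dx_zero_basisVector_zero`. [folklore] -/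
theorem higherOrder_dxZeroE0_EF : (E4.dx 0 : E4 →L[ℝ] ℝ) (E4.basisVector 0) = 1 :=
  higherOrder_dx_zero_basisVector_zero

end Summit.FinalStateConjecture.FinalStateConjecture.Theorems.SublinearIsFree.Slaving

end
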